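import Summits.Langlands.Langlands.Theorems.PicardMuOrdinaryMuOrdinaryFamilyRTThorneAuxiliaryFieldLemmas
import HarnessLib

/-!
# Crux `MuOrdinaryFamilyRT` (stmt-Langlands-13757), line `thorne-minimal-lift`:
# G1 `Missing.auxiliaryCMField` — the auxiliary CM field `F' = K(√-p) = ℚ(ζ₃, √-p)` (stub `stub_auxiliaryCMField`)

G1 (…ThorneCompanionsDebts § 3) asks, for `(f, ρ_C)` in the main class and any family `𝓕`, for a number
field `F'`, Galois over `ℚ`, CM, quadratic over `K = ℚ(ζ₃)`, over which the heart `r̄_f^B` keeps its image,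
with `F'/F'⁺` unramified at every finite place and every place above `3` moved by complex conjugation.
This file proves it (`stub_auxiliaryCMField`, § 2) with the WITNESS `F' = K(√-p)` — the tree's
`QuadraticFamily.sqrtNegField K p = QuadraticAlgebra K (-p) 0` — for a prime `p ≡ 2 (mod 3)` beyond
`|disc f|` (Dirichlet, Mathlib `Nat.forall_exists_prime_gt_and_eq_mod`); `F' = ℚ(√-3, √-p)` is the
biquadratic field with `F'⁺ = ℚ(√3p)` (the Debts file suggests `ℚ(ζ₃, √d)`, `d ≡ 6 (mod 9)`: `d = 3p`).

§ 1, about `K(√-p)`: `-p ∉ K²` (a rational square in `K` lies in `ℚ² ∪ -3ℚ²`,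
`isSquare_or_of_isSquare_ratCast`; `p`-adic valuation), so `K(√-p)` is a field, a number field, quadratic
over `K` (tree instances); `disc f ∉ K(√-p)²` when `disc f ∉ ℚ² ∪ -3ℚ²` and `p ∤ disc f` (a square root
`a + b√-p` has `ab = 0`); `K(√-p)` is Galois over `ℚ` (the fixed field of the `ℚ`-automorphisms
`a + b√-p ↦ σ(a) - σ(b)√-p`, `σ ∈ Gal(K/ℚ)`, tree `PatchingFamily.conjAlgEquiv`, is `ℚ`); it is CM (tree
`PatchingFamily.isCMField_sqrtNegField`, `K` being CM).  § 2 assembles with the criteria of the companion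
file …ThorneAuxiliaryFieldLemmas (`range_rbar_comp_absGaloisRestrict`; `auxiliaryField_criteria` applied to
the algebraic integers `ζ₃` and `√-p`).
-/

set_option linter.dupNamespace false -- `Summit.Langlands.Langlands.…` is the problem's namespace

namespace Summit.Langlands.Langlands.Cruxes.MuOrdinaryFamilyRT.ThorneMinimalLift

open scoped NumberField Polynomial Matrix Classical
open Field IsDedekindDomain Polynomial NumberField
open Literature.NumberTheory.GaloisRepresentations Literature.NumberTheory.Automorphic
open Literature.NumberTheory.GaloisRepresentations.QuadraticFamily
open Summit.Langlands.Langlands.Cruxes.MuOrdinaryFamilyRT.CharZeroDominance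
open Summit.Langlands.Langlands.Theorems.ResidualAutomorphyEven (discr_map_of_injective)

noncomputable section

/-! ## 1. The witness `F' = K(√-p)`, `p ≡ 2 (mod 3)` prime, `p ∤ disc f` -/

section Witness

/-- `p·m` is not a rational square for a prime `p ∤ m`. -/
theorem not_isSquare_intCast_prime_mul {p : ℕ} (hp : p.Prime) {m : ℤ} (hm : ¬ (p : ℤ) ∣ m) :
    ¬ IsSquare (((p : ℤ) * m : ℤ) : ℚ) := by
  rw [Rat.isSquare_intCast_iff]
  rintro ⟨r, hr⟩
  have hpz : Prime (p : ℤ) := Nat.prime_iff_prime_int.mp hp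
  have h1 : (p : ℤ) ∣ r * r := ⟨m, hr.symm⟩
  obtain ⟨t, rfl⟩ : (p : ℤ) ∣ r := (hpz.dvd_or_dvd h1).elim id id
  refine hm ⟨t * t, mul_left_cancel₀ hpz.ne_zero ?_⟩
  rw [hr]
  ring

/-- A prime `p ≠ 3` does not divide `3m` unless it divides `m`. -/
theorem not_dvd_three_mul {p : ℕ} (hp : p.Prime) (hp3 : p ≠ 3) {m : ℤ} (hm : ¬ (p : ℤ) ∣ m) :
    ¬ (p : ℤ) ∣ 3 * m := by
  intro h
  rcases (Nat.prime_iff_prime_int.mp hp).dvd_or_dvd h with h3 | h3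
  · have : p ∣ 3 := by exact_mod_cast h3
    exact hp3 ((Nat.prime_dvd_prime_iff_eq hp Nat.prime_three).mp this)
  · exact hm h3

/-- **`-p` is not a square in `K = ℚ(ζ₃)`** for a prime `p ≠ 3` (a rational square in `K` lies in
`ℚ² ∪ -3ℚ²`; `-p < 0` and `3p` has `p`-adic valuation `1`). -/
theorem not_isSquare_neg_natCast_K {p : ℕ} (hp : p.Prime) (hp3 : p ≠ 3) : ¬ IsSquare (-(p : K)) := by
  intro h
  have h' : IsSquare (((-(p : ℤ) : ℤ) : ℚ) : K) := by push_cast; exact h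
  rcases isSquare_or_of_isSquare_ratCast _ h' with ⟨r, hr⟩ | h1
  · have h0 : (0 : ℚ) ≤ ((-(p : ℤ) : ℤ) : ℚ) := by rw [hr]; exact mul_self_nonneg r
    push_cast at h0
    have : (0 : ℚ) < p := by exact_mod_cast hp.pos
    linarith
  · have e : (-3 : ℚ) * ((-(p : ℤ) : ℤ) : ℚ) = (((p : ℤ) * 3 : ℤ) : ℚ) := by push_cast; ring
    rw [e] at h1
    refine not_isSquare_intCast_prime_mul hp (m := 3) (fun h3 => hp3 ?_) h1
    have : p ∣ 3 := by exact_mod_cast h3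
    exact (Nat.prime_dvd_prime_iff_eq hp Nat.prime_three).mp this

/-- **`disc f` is not a square in `K(√-p)`** when `disc f ∉ ℚ² ∪ -3ℚ²` and `p ∤ 3·disc f`: writing a square
root as `a + b√-p`, `2ab = 0`; `b = 0` puts `disc f` in `K² ∩ ℚ = ℚ² ∪ -3ℚ²`, `a = 0` makes `-p·disc f` a
square in `K`, i.e. `-p·disc f ∈ ℚ²` or `3p·disc f ∈ ℚ²`, both of `p`-adic valuation `1`. -/
theorem not_isSquare_discr_sqrtNegField {f : ℤ[X]} (hgen : Generic f)
    (hD : ¬ IsSquare (f.map (Int.castRingHom ℚ)).discr)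
    (hD3 : ¬ IsSquare ((-3 : ℚ) * (f.map (Int.castRingHom ℚ)).discr))
    {p : ℕ} (hp : p.Prime) (hp3 : p ≠ 3) (hpd : ¬ (p : ℤ) ∣ f.discr) [Fact (¬ IsSquare (-(p : K)))] :
    ¬ IsSquare ((f.discr : ℤ) : sqrtNegField K p) := by
  have hdeg : 0 < f.degree := by
    rw [degree_eq_natDegree (FreeSeedSmoothRt.ne_zero_of_generic hgen), hgen.1]; norm_num
  have hdisc : (f.map (Int.castRingHom ℚ)).discr = (f.discr : ℚ) := by
    rw [discr_map_of_injective _ (Int.castRingHom ℚ).injective_int f hdeg, eq_intCast]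
  rw [hdisc] at hD hD3
  rintro ⟨x, hx⟩
  have hre := congrArg QuadraticAlgebra.re hx
  have him := congrArg QuadraticAlgebra.im hx
  simp only [QuadraticAlgebra.re_intCast, QuadraticAlgebra.im_intCast, QuadraticAlgebra.re_mul,
    QuadraticAlgebra.im_mul, zero_mul, add_zero] at hre him
  have hab : (2 : K) * (x.re * x.im) = 0 := by linear_combination -him
  rcases mul_eq_zero.mp ((mul_eq_zero.mp hab).resolve_left two_ne_zero) with ha | hb
  · have hsq : IsSquare ((((p : ℤ) * -f.discr : ℤ) : ℚ) : K) :=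
      ⟨(p : K) * x.im, by push_cast; rw [hre, ha]; ring⟩
    rcases isSquare_or_of_isSquare_ratCast _ hsq with h1 | h1
    · exact not_isSquare_intCast_prime_mul hp (m := -f.discr) (by rwa [dvd_neg]) h1
    · have e : (-3 : ℚ) * (((p : ℤ) * -f.discr : ℤ) : ℚ) = (((p : ℤ) * (3 * f.discr) : ℤ) : ℚ) := by
        push_cast; ring
      rw [e] at h1
      exact not_isSquare_intCast_prime_mul hp (not_dvd_three_mul hp hp3 hpd) h1
  · have hsq : IsSquare (((f.discr : ℤ) : ℚ) : K) := ⟨x.re, by push_cast; rw [hre, hb]; ring⟩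
    rcases isSquare_or_of_isSquare_ratCast _ hsq with h1 | h1
    · exact hD h1
    · exact hD3 h1

/-- **`K(√-p)` is Galois over `ℚ`**: an element fixed by the `ℚ`-automorphisms
`a + b√-p ↦ σ(a) - σ(b)√-p` (`σ ∈ Gal(K/ℚ)`, tree `PatchingFamily.conjAlgEquiv`) has `b = 0` and
`a ∈ K^{Gal(K/ℚ)} = ℚ`. -/
theorem isGalois_rat_sqrtNegField (p : ℕ) [Fact (¬ IsSquare (-(p : K)))] :
    IsGalois ℚ (sqrtNegField K p) := by
  refine IsGalois.of_fixedField_eq_bot ℚ _ ?_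
  rw [eq_bot_iff]
  intro x hx
  rw [IntermediateField.mem_fixedField_iff] at hx
  have h : ∀ σ : K ≃ₐ[ℚ] K, σ x.re = x.re ∧ -(σ x.im) = x.im := fun σ => by
    have h1 := hx (PatchingFamily.conjAlgEquiv (D := p) σ.toRingEquiv) (Subgroup.mem_top _)
    exact ⟨by simpa using congrArg QuadraticAlgebra.re h1, by simpa using congrArg QuadraticAlgebra.im h1⟩
  have him : x.im = 0 := by
    have h1 := (h AlgEquiv.refl).2
    have h2 : (2 : K) * x.im = 0 := by
      simp only [AlgEquiv.coe_refl, id_eq] at h1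
      linear_combination -h1
    simpa using h2
  have hre : x.re ∈ (⊥ : IntermediateField ℚ K) := by
    rw [← IsGalois.fixedField_top, IntermediateField.mem_fixedField_iff]
    exact fun σ _ => (h σ).1
  obtain ⟨q, hq⟩ := IntermediateField.mem_bot.mp hre
  refine IntermediateField.mem_bot.mpr ⟨q, ?_⟩
  rw [IsScalarTower.algebraMap_apply ℚ K (sqrtNegField K p), hq]
  ext
  · rfl
  · rw [QuadraticAlgebra.algebraMap_im, him]

/-- `ζ₃ ∈ K` satisfies `ζ² + ζ + 1 = 0`. -/
theorem zeta_sq_add_zeta_add_one :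
    haveI := FreeSeedSmoothRt.isCyclotomicExtensionK
    (IsCyclotomicExtension.zeta 3 ℚ K) ^ 2 + IsCyclotomicExtension.zeta 3 ℚ K + 1 = 0 := by
  haveI := FreeSeedSmoothRt.isCyclotomicExtensionK
  have h := (IsCyclotomicExtension.zeta_spec 3 ℚ K).isRoot_cyclotomic (by norm_num)
  rw [Polynomial.cyclotomic_three, IsRoot.def] at h
  simpa [eval_add, eval_pow, eval_X, eval_one] using h

end Witness

/-! ## 2. The registered stub -/

/-- **G1 — `Missing.auxiliaryCMField` (stub `stub_auxiliaryCMField` of line `thorne-minimal-lift`).**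
For `(f, ρ_C)` in the main class (indeed for generic `f` with `disc f ∉ ℚ² ∪ -3ℚ²`) and any family `𝓕`,
the field `F' = K(√-p) = ℚ(ζ₃, √-p)`, `p ≡ 2 (mod 3)` a prime with `p ∤ disc f`, is a number field, Galois
over `ℚ`, CM, quadratic over `K`, keeps the image of `r̄_f^B` on `Γ_{F'}`, has `F'/F'⁺` unramified at all
finite places, and every place above `3` is moved by complex conjugation. -/
theorem stub_auxiliaryCMField : Missing.auxiliaryCMField := by
  intro f ι e S₀ ρC 𝓕 hgen _hPI hMC
  obtain ⟨⟨-, hD, hD3⟩, -⟩ := hMC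
  haveI := FreeSeedSmoothRt.isCyclotomicExtensionK
  -- `disc f ≠ 0`
  have hdeg : 0 < f.degree := by
    rw [degree_eq_natDegree (FreeSeedSmoothRt.ne_zero_of_generic hgen), hgen.1]; norm_num
  have hdisc : (f.map (Int.castRingHom ℚ)).discr = (f.discr : ℚ) := by
    rw [discr_map_of_injective _ (Int.castRingHom ℚ).injective_int f hdeg, eq_intCast]
  have hd0 : f.discr ≠ 0 := fun h0 => hD ⟨0, by rw [hdisc, h0]; simp⟩
  -- a prime `p ≡ 2 (mod 3)` beyond `|disc f|`
  obtain ⟨p, hpgt, hp, hpmod⟩ := Nat.forall_exists_prime_gt_and_eq_mod (q := 3) (a := 2)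
    (isUnit_iff_ne_zero.mpr (by decide)) f.discr.natAbs
  have hp31 : 3 ∣ p + 1 := by
    have h' : (p : ZMod 3) = ((2 : ℕ) : ZMod 3) := by rw [hpmod]; rfl
    rw [ZMod.natCast_eq_natCast_iff'] at h'
    omega
  have hp3 : p ≠ 3 := by omega
  have hpd : ¬ (p : ℤ) ∣ f.discr := fun h => by
    have hle := Nat.le_of_dvd (Int.natAbs_pos.mpr hd0) (Int.natAbs_dvd_natAbs.mpr h)
    rw [Int.natAbs_natCast] at hle
    omega
  haveI : Fact (¬ IsSquare (-(p : K))) := ⟨not_isSquare_neg_natCast_K hp hp3⟩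
  haveI hG : IsGalois ℚ (sqrtNegField K p) := isGalois_rat_sqrtNegField p
  haveI hCM : IsCMField (sqrtNegField K p) :=
    PatchingFamily.isCMField_sqrtNegField (Or.inr isCMField_K) hp.ne_zero
  -- the two generators `ζ₃`, `√-p` of `𝓞 F'`
  set ζ : K := IsCyclotomicExtension.zeta 3 ℚ K with hζdef
  have hζ : IsPrimitiveRoot ζ 3 := IsCyclotomicExtension.zeta_spec 3 ℚ K
  have hζ' : IsPrimitiveRoot (algebraMap K (sqrtNegField K p) ζ) 3 :=
    hζ.map_of_injective (algebraMap K (sqrtNegField K p)).injective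
  let x : 𝓞 (sqrtNegField K p) := ⟨algebraMap K (sqrtNegField K p) ζ, hζ'.isIntegral (by norm_num)⟩
  have hx : x ^ 2 + x + 1 = 0 := by
    apply RingOfIntegers.ext
    change (algebraMap K (sqrtNegField K p) ζ) ^ 2 + algebraMap K (sqrtNegField K p) ζ + 1 = 0
    rw [← map_pow, ← map_add, ← map_one (algebraMap K (sqrtNegField K p)), ← map_add,
      zeta_sq_add_zeta_add_one, map_zero]
  have hω : (QuadraticAlgebra.omega : sqrtNegField K p) ^ 2 = -(p : sqrtNegField K p) := by
    rw [omega_sq, map_neg, map_natCast]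
  let s : 𝓞 (sqrtNegField K p) := ⟨QuadraticAlgebra.omega,
    ⟨X ^ 2 + C (p : ℤ), monic_X_pow_add_C _ two_ne_zero, by simp [hω]⟩⟩
  have hs : s ^ 2 = -(p : 𝓞 (sqrtNegField K p)) := by
    apply RingOfIntegers.ext
    change (QuadraticAlgebra.omega : sqrtNegField K p) ^ 2 = _
    rw [hω]
    simp
  refine ⟨sqrtNegField K p, inferInstance, inferInstance, inferInstance, hG, hCM, finrank_sqrtNegField,
    range_rbar_comp_absGaloisRestrict hgen hD hD3 _ finrank_sqrtNegField
      (not_isSquare_discr_sqrtNegField hgen hD hD3 hp hp3 hpd) 𝓕.B,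
    auxiliaryField_criteria _ x s p hx hp.ne_zero hs hp31⟩

end

end Summit.Langlands.Langlands.Cruxes.MuOrdinaryFamilyRT.ThorneMinimalLift
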